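import Mathlib
import HarnessLib

/-!
# Solovay–Kitaev theorem: matrix-norm toolkit and the two commutator estimates

Proof infrastructure for the discharge of
`Literature.Computability.QuantumComplexity.solovay_kitaev` (the Solovay–Kitaev theorem,
Dawson–Nielsen, *The Solovay–Kitaev algorithm*, QIC **6** (2006) = arXiv:quant-ph/0505030,
Theorem 1; Kitaev 1997).  Everything here is elementary analysis in the C⋆-algebra
`Matrix n n ℂ` with its `L²`-operator norm (Mathlib's scoped instances
`Matrix.instL2OpNormedRing`, `Matrix.instCStarRing`, opened with
`open scoped Matrix.Norms.L2Operator`):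

* norm facts: unitaries have norm `≤ 1`, entries are bounded by the operator norm, products of
  norm-`≤ 1` factors telescope (`norm_list_prod_sub_list_prod_le`);
* `norm_comm_sub_comm_le` — Dawson–Nielsen Lemma 1 (§4.2, "approximating a commutator"): if
  `V, W` are unitaries within `η` of `1` and `V', W'` are unitaries within `δ` of `V, W`, then
  `‖V'W'V'⋆W'⋆ - VWV⋆W⋆‖ ≤ 16 η δ + 14 δ²` (DN print `8Δδ + 4Δδ² + 8Δ² + 4Δ³ + Δ⁴` with strict
  inequalities; we prove a version with slightly larger, fully explicit constants);
* `norm_comm_sub_one_sub_bracket_le` — the second-order expansion of a group commutator of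
  unitaries near `1`: if `‖V - 1 - b‖, ‖W - 1 - c‖ ≤ ρ` and `‖b‖, ‖c‖ ≤ η` then
  `‖VWV⋆W⋆ - 1 - [b, c]‖ ≤ 4 (η + ρ)³ + 4 η ρ + 2 ρ²`.  This replaces Dawson–Nielsen Lemma 3
  (a BCH estimate for matrix exponentials) and rests on the exact identity
  `VWV⋆W⋆ - 1 = (VW - WV) V⋆W⋆`.

No definitions and no new statements of results are introduced in this file.
-/

noncomputable section

open scoped Matrix.Norms.L2Operator

namespace Literature.Computability.QuantumComplexity.SolovayKitaev

open Matrix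

variable {n : Type*} [Fintype n] [DecidableEq n]

/-! ### Norm toolkit for `Matrix n n ℂ` with the `L²`-operator norm -/

/-- `‖1‖ ≤ 1` in `Matrix n n ℂ` (it is `1` unless `n` is empty). [folklore] -/
theorem norm_one_le_one : ‖(1 : Matrix n n ℂ)‖ ≤ 1 := by
  rcases subsingleton_or_nontrivial (Matrix n n ℂ) with h | h
  · simp [Subsingleton.elim (1 : Matrix n n ℂ) 0]
  · exact norm_one.le

/-- A unitary matrix has operator norm `≤ 1`. [folklore] -/
theorem norm_le_one_of_mem_unitaryGroup {U : Matrix n n ℂ} (hU : U ∈ Matrix.unitaryGroup n ℂ) :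
    ‖U‖ ≤ 1 := by
  have h := CStarRing.norm_mem_unitary_mul (1 : Matrix n n ℂ) hU
  rw [mul_one] at h
  rw [h]
  exact norm_one_le_one

/-- The conjugate transpose of a unitary matrix has operator norm `≤ 1`. [folklore] -/
theorem norm_star_le_one_of_mem_unitaryGroup {U : Matrix n n ℂ}
    (hU : U ∈ Matrix.unitaryGroup n ℂ) : ‖star U‖ ≤ 1 := by
  rw [norm_star]
  exact norm_le_one_of_mem_unitaryGroup hU

/-- Elements of `SU(n)` have operator norm `≤ 1`. [folklore] -/
theorem norm_coe_le_one (U : Matrix.specialUnitaryGroup n ℂ) : ‖(U : Matrix n n ℂ)‖ ≤ 1 :=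
  norm_le_one_of_mem_unitaryGroup U.2.1

/-- Left multiplication by an element of `SU(n)` is isometric. [folklore] -/
theorem norm_coe_mul (U : Matrix.specialUnitaryGroup n ℂ) (A : Matrix n n ℂ) :
    ‖(U : Matrix n n ℂ) * A‖ = ‖A‖ :=
  CStarRing.norm_mem_unitary_mul A U.2.1

/-- Right multiplication by an element of `SU(n)` is isometric. [folklore] -/
theorem norm_mul_coe (A : Matrix n n ℂ) (U : Matrix.specialUnitaryGroup n ℂ) :
    ‖A * (U : Matrix n n ℂ)‖ = ‖A‖ :=
  CStarRing.norm_mul_mem_unitary A U.2.1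

/-- In `SU(n)` the inverse is the conjugate transpose (as matrices). [folklore] -/
theorem coe_inv (U : Matrix.specialUnitaryGroup n ℂ) :
    ((U⁻¹ : Matrix.specialUnitaryGroup n ℂ) : Matrix n n ℂ) = star (U : Matrix n n ℂ) := rfl

/-- Conjugation by an element of `SU(n)` is isometric. [folklore] -/
theorem norm_conj (U : Matrix.specialUnitaryGroup n ℂ) (A : Matrix n n ℂ) :
    ‖(U : Matrix n n ℂ) * A * ((U⁻¹ : Matrix.specialUnitaryGroup n ℂ) : Matrix n n ℂ)‖ = ‖A‖ := by
  rw [norm_mul_coe, norm_coe_mul]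

/-- Every entry of a matrix is bounded by its `L²`-operator norm. [folklore] -/
theorem norm_apply_le_norm (A : Matrix n n ℂ) (i j : n) : ‖A i j‖ ≤ ‖A‖ := by
  have h := Matrix.l2_opNorm_mulVec A (EuclideanSpace.single j (1 : ℂ))
  have h1 : ‖(EuclideanSpace.single j (1 : ℂ))‖ = 1 := by simp
  rw [h1, mul_one] at h
  refine le_trans ?_ h
  refine le_trans (le_of_eq ?_) (PiLp.norm_apply_le _ i)
  simp

/-- A product of matrices of norm `≤ 1` has norm `≤ 1`. [folklore] -/
theorem norm_list_prod_le_one {ι : Type*} (l : List ι) (f : ι → Matrix n n ℂ)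
    (hf : ∀ i ∈ l, ‖f i‖ ≤ 1) : ‖(l.map f).prod‖ ≤ 1 := by
  induction l with
  | nil => simpa using norm_one_le_one
  | cons a l ih =>
    rw [List.map_cons, List.prod_cons]
    have ha := hf a (by simp)
    have ih' := ih (fun i hi => hf i (by simp [hi]))
    calc ‖f a * (l.map f).prod‖ ≤ ‖f a‖ * ‖(l.map f).prod‖ := norm_mul_le _ _
      _ ≤ 1 * 1 := mul_le_mul ha ih' (norm_nonneg _) zero_le_one
      _ = 1 := one_mul 1

/-- **Telescoping.** Two products of norm-`≤ 1` matrices differ by at most the sum of the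
distances of their factors. [folklore] -/
theorem norm_list_prod_sub_list_prod_le {ι : Type*} (l : List ι) (f g : ι → Matrix n n ℂ)
    (hf : ∀ i ∈ l, ‖f i‖ ≤ 1) (hg : ∀ i ∈ l, ‖g i‖ ≤ 1) :
    ‖(l.map f).prod - (l.map g).prod‖ ≤ (l.map fun i => ‖f i - g i‖).sum := by
  induction l with
  | nil => simp
  | cons a l ih =>
    simp only [List.map_cons, List.prod_cons, List.sum_cons]
    have ha := hg a (by simp)
    have hP := norm_list_prod_le_one l f (fun i hi => hf i (by simp [hi]))
    have ih' := ih (fun i hi => hf i (by simp [hi])) (fun i hi => hg i (by simp [hi]))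
    calc ‖f a * (l.map f).prod - g a * (l.map g).prod‖
        = ‖(f a - g a) * (l.map f).prod + g a * ((l.map f).prod - (l.map g).prod)‖ := by
          congr 1; noncomm_ring
      _ ≤ ‖f a - g a‖ * ‖(l.map f).prod‖ + ‖g a‖ * ‖(l.map f).prod - (l.map g).prod‖ :=
          (norm_add_le _ _).trans (add_le_add (norm_mul_le _ _) (norm_mul_le _ _))
      _ ≤ ‖f a - g a‖ * 1 + 1 * ‖(l.map f).prod - (l.map g).prod‖ := by
          gcongr
      _ ≤ ‖f a - g a‖ + (l.map fun i => ‖f i - g i‖).sum := by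
          rw [mul_one, one_mul]; gcongr

/-- `‖X Y - 1‖ ≤ ‖X - 1‖ + ‖Y - 1‖` when `‖Y‖ ≤ 1`. [folklore] -/
theorem norm_mul_sub_one_le {X Y : Matrix n n ℂ} (hY : ‖Y‖ ≤ 1) :
    ‖X * Y - 1‖ ≤ ‖X - 1‖ + ‖Y - 1‖ := by
  calc ‖X * Y - 1‖ = ‖(X - 1) * Y + (Y - 1)‖ := by congr 1; noncomm_ring
    _ ≤ ‖X - 1‖ * ‖Y‖ + ‖Y - 1‖ := (norm_add_le _ _).trans (by gcongr; exact norm_mul_le _ _)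
    _ ≤ ‖X - 1‖ * 1 + ‖Y - 1‖ := by gcongr
    _ = ‖X - 1‖ + ‖Y - 1‖ := by rw [mul_one]

/-! ### Dawson–Nielsen Lemma 1: approximating a commutator -/

/-- **Dawson–Nielsen Lemma 1** (QIC 6 (2006) §4.2), explicit-constant form.  If `V, W` are
unitary matrices within `η` of the identity and `V', W'` are unitary matrices within `δ` of
`V, W` respectively, then the group commutators satisfy
`‖V'W'V'⋆W'⋆ - VWV⋆W⋆‖ ≤ 16 η δ + 14 δ²`: the first-order error terms cancel because
`d V⋆ + V d⋆ = -d d⋆` for `d = V' - V`. [cite: DawsonNielsen2006, Lemma 1] -/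
theorem norm_comm_sub_comm_le {V W V' W' : Matrix n n ℂ}
    (hV : V ∈ Matrix.unitaryGroup n ℂ) (hW : W ∈ Matrix.unitaryGroup n ℂ)
    (hV' : V' ∈ Matrix.unitaryGroup n ℂ) (hW' : W' ∈ Matrix.unitaryGroup n ℂ)
    {η δ : ℝ} (hV1 : ‖V - 1‖ ≤ η) (hW1 : ‖W - 1‖ ≤ η)
    (hVV : ‖V' - V‖ ≤ δ) (hWW : ‖W' - W‖ ≤ δ) :
    ‖V' * W' * star V' * star W' - V * W * star V * star W‖ ≤ 16 * η * δ + 14 * δ ^ 2 := by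
  have hδ : 0 ≤ δ := (norm_nonneg _).trans hVV
  have hη : 0 ≤ η := (norm_nonneg _).trans hV1
  -- norms of the unitaries and of their adjoints
  have nV := norm_le_one_of_mem_unitaryGroup hV
  have nW := norm_le_one_of_mem_unitaryGroup hW
  have nV' := norm_le_one_of_mem_unitaryGroup hV'
  have nW' := norm_le_one_of_mem_unitaryGroup hW'
  have nsV := norm_star_le_one_of_mem_unitaryGroup hV
  have nsW := norm_star_le_one_of_mem_unitaryGroup hW
  have nsV' := norm_star_le_one_of_mem_unitaryGroup hV'
  have nsW' := norm_star_le_one_of_mem_unitaryGroup hW'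
  -- distances to the identity
  have hV'1 : ‖V' - 1‖ ≤ η + δ := by
    calc ‖V' - 1‖ = ‖(V' - V) + (V - 1)‖ := by congr 1; abel
      _ ≤ ‖V' - V‖ + ‖V - 1‖ := norm_add_le _ _
      _ ≤ δ + η := add_le_add hVV hV1
      _ = η + δ := add_comm _ _
  have hW'1 : ‖W' - 1‖ ≤ η + δ := by
    calc ‖W' - 1‖ = ‖(W' - W) + (W - 1)‖ := by congr 1; abel
      _ ≤ ‖W' - W‖ + ‖W - 1‖ := norm_add_le _ _
      _ ≤ δ + η := add_le_add hWW hW1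
      _ = η + δ := add_comm _ _
  have hsub1 : ∀ X : Matrix n n ℂ, ‖star X - 1‖ = ‖X - 1‖ := fun X => by
    rw [← norm_star (X - 1), star_sub, star_one]
  have hsV1 : ‖star V - 1‖ ≤ η := (hsub1 V).le.trans hV1
  have hsV'1 : ‖star V' - 1‖ ≤ η + δ := (hsub1 V').le.trans hV'1
  have hsW'1 : ‖star W' - 1‖ ≤ η + δ := (hsub1 W').le.trans hW'1
  -- the perturbations
  set d₁ : Matrix n n ℂ := V' - V with hd₁
  set d₂ : Matrix n n ℂ := W' - W with hd₂
  have nd₁ : ‖d₁‖ ≤ δ := hVV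
  have nd₂ : ‖d₂‖ ≤ δ := hWW
  have nsd₁ : ‖star d₁‖ ≤ δ := by rw [norm_star]; exact hVV
  have nsd₂ : ‖star d₂‖ ≤ δ := by rw [norm_star]; exact hWW
  -- telescoping identity
  have hident : V' * W' * star V' * star W' - V * W * star V * star W =
      d₁ * (W' * star V' * star W') + V * d₂ * (star V' * star W') +
        V * W * star d₁ * star W' + V * W * star V * star d₂ := by
    simp only [hd₁, hd₂, star_sub]
    noncomm_ring
  -- the four first-order terms and their cores
  have h1 : ‖d₁ * (W' * star V' * star W') - d₁‖ ≤ δ * (3 * (η + δ)) := by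
    have hc : ‖W' * star V' * star W' - 1‖ ≤ 3 * (η + δ) := by
      calc ‖W' * star V' * star W' - 1‖
          ≤ ‖W' * star V' - 1‖ + ‖star W' - 1‖ := norm_mul_sub_one_le nsW'
        _ ≤ (‖W' - 1‖ + ‖star V' - 1‖) + ‖star W' - 1‖ := by
            gcongr; exact norm_mul_sub_one_le nsV'
        _ ≤ ((η + δ) + (η + δ)) + (η + δ) := by gcongr
        _ = 3 * (η + δ) := by ring
    calc ‖d₁ * (W' * star V' * star W') - d₁‖ = ‖d₁ * (W' * star V' * star W' - 1)‖ := by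
          congr 1; noncomm_ring
      _ ≤ ‖d₁‖ * ‖W' * star V' * star W' - 1‖ := norm_mul_le _ _
      _ ≤ δ * (3 * (η + δ)) := by gcongr
  have h2 : ‖V * d₂ * (star V' * star W') - d₂‖ ≤ δ * (3 * (η + δ)) := by
    have hc : ‖star V' * star W' - 1‖ ≤ 2 * (η + δ) := by
      calc ‖star V' * star W' - 1‖ ≤ ‖star V' - 1‖ + ‖star W' - 1‖ := norm_mul_sub_one_le nsW'
        _ ≤ (η + δ) + (η + δ) := by gcongr
        _ = 2 * (η + δ) := by ring
    calc ‖V * d₂ * (star V' * star W') - d₂‖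
        = ‖(V - 1) * (d₂ * (star V' * star W')) + d₂ * (star V' * star W' - 1)‖ := by
          congr 1; noncomm_ring
      _ ≤ ‖V - 1‖ * ‖d₂ * (star V' * star W')‖ + ‖d₂‖ * ‖star V' * star W' - 1‖ :=
          (norm_add_le _ _).trans (add_le_add (norm_mul_le _ _) (norm_mul_le _ _))
      _ ≤ ‖V - 1‖ * (‖d₂‖ * (‖star V'‖ * ‖star W'‖)) + ‖d₂‖ * ‖star V' * star W' - 1‖ := by
          gcongr
          exact (norm_mul_le _ _).trans (by gcongr; exact norm_mul_le _ _)
      _ ≤ η * (δ * (1 * 1)) + δ * (2 * (η + δ)) := by gcongr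
      _ ≤ δ * (3 * (η + δ)) := by nlinarith
  have h3 : ‖V * W * star d₁ * star W' - star d₁‖ ≤ δ * (3 * (η + δ)) := by
    have hc : ‖V * W - 1‖ ≤ 2 * η := by
      calc ‖V * W - 1‖ ≤ ‖V - 1‖ + ‖W - 1‖ := norm_mul_sub_one_le nW
        _ ≤ η + η := by gcongr
        _ = 2 * η := by ring
    calc ‖V * W * star d₁ * star W' - star d₁‖
        = ‖(V * W - 1) * (star d₁ * star W') + star d₁ * (star W' - 1)‖ := by
          congr 1; noncomm_ring
      _ ≤ ‖V * W - 1‖ * ‖star d₁ * star W'‖ + ‖star d₁‖ * ‖star W' - 1‖ :=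
          (norm_add_le _ _).trans (add_le_add (norm_mul_le _ _) (norm_mul_le _ _))
      _ ≤ ‖V * W - 1‖ * (‖star d₁‖ * ‖star W'‖) + ‖star d₁‖ * ‖star W' - 1‖ := by
          gcongr; exact norm_mul_le _ _
      _ ≤ (2 * η) * (δ * 1) + δ * (η + δ) := by gcongr
      _ ≤ δ * (3 * (η + δ)) := by nlinarith
  have h4 : ‖V * W * star V * star d₂ - star d₂‖ ≤ δ * (3 * (η + δ)) := by
    have hc : ‖V * W * star V - 1‖ ≤ 3 * η := by
      calc ‖V * W * star V - 1‖ ≤ ‖V * W - 1‖ + ‖star V - 1‖ := norm_mul_sub_one_le nsV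
        _ ≤ (‖V - 1‖ + ‖W - 1‖) + ‖star V - 1‖ := by gcongr; exact norm_mul_sub_one_le nW
        _ ≤ (η + η) + η := by gcongr
        _ = 3 * η := by ring
    calc ‖V * W * star V * star d₂ - star d₂‖ = ‖(V * W * star V - 1) * star d₂‖ := by
          congr 1; noncomm_ring
      _ ≤ ‖V * W * star V - 1‖ * ‖star d₂‖ := norm_mul_le _ _
      _ ≤ (3 * η) * δ := by gcongr
      _ ≤ δ * (3 * (η + δ)) := by nlinarith
  -- the cores cancel to second order
  have hVu : V * star V = 1 := Matrix.mem_unitaryGroup_iff.mp hV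
  have hV'u : V' * star V' = 1 := Matrix.mem_unitaryGroup_iff.mp hV'
  have hWu : W * star W = 1 := Matrix.mem_unitaryGroup_iff.mp hW
  have hW'u : W' * star W' = 1 := Matrix.mem_unitaryGroup_iff.mp hW'
  have hcore : ∀ {X X' d : Matrix n n ℂ}, d = X' - X → X * star X = 1 → X' * star X' = 1 →
      ‖X - 1‖ ≤ η → ‖d‖ ≤ δ → ‖d + star d‖ ≤ δ ^ 2 + 2 * η * δ := by
    intro X X' d hd hX hX' hX1 hdδ
    have hsd : ‖star d‖ ≤ δ := by rw [norm_star]; exact hdδ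
    have hkey : d * star X + X * star d = -(d * star d) := by
      have h' : (X + d) * star (X + d) = 1 := by
        have : X + d = X' := by rw [hd]; abel
        rw [this, hX']
      rw [star_add, add_mul, mul_add, mul_add, hX] at h'
      have h'' : d * star X + X * star d + d * star d = 0 := by
        have := congrArg (fun Y => Y - 1) h'
        simp only [sub_self] at this
        rw [← this]; abel
      rw [← sub_eq_zero, sub_neg_eq_add, h'']
    have hid : d + star d = -(d * star d) - d * (star X - 1) - (X - 1) * star d := by
      rw [← hkey]; noncomm_ring
    rw [hid]
    calc ‖-(d * star d) - d * (star X - 1) - (X - 1) * star d‖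
        ≤ ‖-(d * star d)‖ + ‖d * (star X - 1)‖ + ‖(X - 1) * star d‖ :=
          (norm_sub_le _ _).trans (add_le_add (norm_sub_le _ _) le_rfl)
      _ ≤ ‖d‖ * ‖star d‖ + ‖d‖ * ‖star X - 1‖ + ‖X - 1‖ * ‖star d‖ := by
          rw [norm_neg]
          exact add_le_add (add_le_add (norm_mul_le _ _) (norm_mul_le _ _)) (norm_mul_le _ _)
      _ ≤ δ * δ + δ * η + η * δ := by
          have hsX1 : ‖star X - 1‖ ≤ η := (hsub1 X).le.trans hX1
          gcongr
      _ = δ ^ 2 + 2 * η * δ := by ring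
  have hc1 : ‖d₁ + star d₁‖ ≤ δ ^ 2 + 2 * η * δ := hcore hd₁ hVu hV'u hV1 nd₁
  have hc2 : ‖d₂ + star d₂‖ ≤ δ ^ 2 + 2 * η * δ := hcore hd₂ hWu hW'u hW1 nd₂
  -- assemble
  rw [hident]
  have hsplit : d₁ * (W' * star V' * star W') + V * d₂ * (star V' * star W') +
        V * W * star d₁ * star W' + V * W * star V * star d₂ =
      ((d₁ + star d₁) + (d₂ + star d₂)) +
      ((d₁ * (W' * star V' * star W') - d₁) + (V * d₂ * (star V' * star W') - d₂) +
        (V * W * star d₁ * star W' - star d₁) + (V * W * star V * star d₂ - star d₂)) := by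
    abel
  rw [hsplit]
  calc _ ≤ ‖(d₁ + star d₁) + (d₂ + star d₂)‖ +
        ‖(d₁ * (W' * star V' * star W') - d₁) + (V * d₂ * (star V' * star W') - d₂) +
          (V * W * star d₁ * star W' - star d₁) + (V * W * star V * star d₂ - star d₂)‖ :=
        norm_add_le _ _
    _ ≤ (‖d₁ + star d₁‖ + ‖d₂ + star d₂‖) +
        (‖d₁ * (W' * star V' * star W') - d₁‖ + ‖V * d₂ * (star V' * star W') - d₂‖ +
          ‖V * W * star d₁ * star W' - star d₁‖ + ‖V * W * star V * star d₂ - star d₂‖) := by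
        gcongr
        · exact norm_add_le _ _
        · exact (norm_add_le _ _).trans (add_le_add ((norm_add_le _ _).trans
            (add_le_add (norm_add_le _ _) le_rfl)) le_rfl)
    _ ≤ ((δ ^ 2 + 2 * η * δ) + (δ ^ 2 + 2 * η * δ)) +
        (δ * (3 * (η + δ)) + δ * (3 * (η + δ)) + δ * (3 * (η + δ)) + δ * (3 * (η + δ))) := by
        gcongr
    _ = 16 * η * δ + 14 * δ ^ 2 := by ring

/-! ### Second-order expansion of a group commutator -/

/-- **Commutator expansion.**  For unitary matrices `V, W` with `‖V - 1 - b‖, ‖W - 1 - c‖ ≤ ρ`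
and `‖b‖, ‖c‖ ≤ η`, the group commutator satisfies
`‖VWV⋆W⋆ - 1 - (bc - cb)‖ ≤ 4 (η + ρ)³ + 4 η ρ + 2 ρ²`.  Proof: the exact identity
`VWV⋆W⋆ - 1 = (VW - WV) V⋆W⋆` (as `WVV⋆W⋆ = 1`) and `VW - WV = vw - wv` for `v = V - 1`,
`w = W - 1`.  (Stands in for Dawson–Nielsen Lemma 3, the third-order BCH estimate.)
[folklore] -/
theorem norm_comm_sub_one_sub_bracket_le {V W : Matrix n n ℂ}
    (hV : V ∈ Matrix.unitaryGroup n ℂ) (hW : W ∈ Matrix.unitaryGroup n ℂ)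
    (b c : Matrix n n ℂ) {η ρ : ℝ}
    (hb : ‖b‖ ≤ η) (hc : ‖c‖ ≤ η) (hVb : ‖V - 1 - b‖ ≤ ρ) (hWc : ‖W - 1 - c‖ ≤ ρ) :
    ‖V * W * star V * star W - 1 - (b * c - c * b)‖ ≤
      4 * (η + ρ) ^ 3 + 4 * η * ρ + 2 * ρ ^ 2 := by
  have hη : 0 ≤ η := (norm_nonneg _).trans hb
  have hρ : 0 ≤ ρ := (norm_nonneg _).trans hVb
  have hVu : V * star V = 1 := Matrix.mem_unitaryGroup_iff.mp hV
  have hWu : W * star W = 1 := Matrix.mem_unitaryGroup_iff.mp hW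
  have nsW := norm_star_le_one_of_mem_unitaryGroup hW
  set v : Matrix n n ℂ := V - 1 with hv
  set w : Matrix n n ℂ := W - 1 with hw
  set r₁ : Matrix n n ℂ := v - b with hr₁
  set r₂ : Matrix n n ℂ := w - c with hr₂
  have nr₁ : ‖r₁‖ ≤ ρ := hVb
  have nr₂ : ‖r₂‖ ≤ ρ := hWc
  have nv : ‖v‖ ≤ η + ρ := by
    calc ‖v‖ = ‖b + r₁‖ := by congr 1; rw [hr₁]; abel
      _ ≤ ‖b‖ + ‖r₁‖ := norm_add_le _ _
      _ ≤ η + ρ := add_le_add hb nr₁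
  have nw : ‖w‖ ≤ η + ρ := by
    calc ‖w‖ = ‖c + r₂‖ := by congr 1; rw [hr₂]; abel
      _ ≤ ‖c‖ + ‖r₂‖ := norm_add_le _ _
      _ ≤ η + ρ := add_le_add hc nr₂
  -- exact identity
  have hident : V * W * star V * star W - 1 = (v * w - w * v) * (star V * star W) := by
    have h1 : (v * w - w * v) * (star V * star W) =
        V * W * star V * star W - W * (V * star V) * star W := by
      simp only [hv, hw]; noncomm_ring
    rw [h1, hVu, mul_one, hWu]
  have hsub1 : ∀ X : Matrix n n ℂ, ‖star X - 1‖ = ‖X - 1‖ := fun X => by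
    rw [← norm_star (X - 1), star_sub, star_one]
  have hstar : ‖star V * star W - 1‖ ≤ 2 * (η + ρ) := by
    calc ‖star V * star W - 1‖ ≤ ‖star V - 1‖ + ‖star W - 1‖ := norm_mul_sub_one_le nsW
      _ = ‖v‖ + ‖w‖ := by rw [hsub1, hsub1]
      _ ≤ (η + ρ) + (η + ρ) := add_le_add nv nw
      _ = 2 * (η + ρ) := by ring
  have hbr : ‖v * w - w * v‖ ≤ 2 * (η + ρ) ^ 2 := by
    calc ‖v * w - w * v‖ ≤ ‖v * w‖ + ‖w * v‖ := norm_sub_le _ _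
      _ ≤ ‖v‖ * ‖w‖ + ‖w‖ * ‖v‖ := add_le_add (norm_mul_le _ _) (norm_mul_le _ _)
      _ ≤ (η + ρ) * (η + ρ) + (η + ρ) * (η + ρ) := by gcongr
      _ = 2 * (η + ρ) ^ 2 := by ring
  have hA : ‖(v * w - w * v) * (star V * star W) - (v * w - w * v)‖ ≤ 4 * (η + ρ) ^ 3 := by
    calc ‖(v * w - w * v) * (star V * star W) - (v * w - w * v)‖
        = ‖(v * w - w * v) * (star V * star W - 1)‖ := by congr 1; noncomm_ring
      _ ≤ ‖v * w - w * v‖ * ‖star V * star W - 1‖ := norm_mul_le _ _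
      _ ≤ (2 * (η + ρ) ^ 2) * (2 * (η + ρ)) := by gcongr
      _ = 4 * (η + ρ) ^ 3 := by ring
  have hB : ‖(v * w - w * v) - (b * c - c * b)‖ ≤ 4 * η * ρ + 2 * ρ ^ 2 := by
    have hvb : v = b + r₁ := by rw [hr₁]; abel
    have hwc : w = c + r₂ := by rw [hr₂]; abel
    have hid : (v * w - w * v) - (b * c - c * b) =
        b * r₂ + r₁ * c + r₁ * r₂ - c * r₁ - r₂ * b - r₂ * r₁ := by
      rw [hvb, hwc]; noncomm_ring
    rw [hid]
    calc ‖b * r₂ + r₁ * c + r₁ * r₂ - c * r₁ - r₂ * b - r₂ * r₁‖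
        ≤ ‖b * r₂‖ + ‖r₁ * c‖ + ‖r₁ * r₂‖ + ‖c * r₁‖ + ‖r₂ * b‖ + ‖r₂ * r₁‖ := by
          refine (norm_sub_le _ _).trans (add_le_add ((norm_sub_le _ _).trans (add_le_add
            ((norm_sub_le _ _).trans (add_le_add ((norm_add_le _ _).trans (add_le_add
              (norm_add_le _ _) le_rfl)) le_rfl)) le_rfl)) le_rfl)
      _ ≤ ‖b‖ * ‖r₂‖ + ‖r₁‖ * ‖c‖ + ‖r₁‖ * ‖r₂‖ + ‖c‖ * ‖r₁‖ + ‖r₂‖ * ‖b‖ + ‖r₂‖ * ‖r₁‖ := by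
          gcongr <;> exact norm_mul_le _ _
      _ ≤ η * ρ + ρ * η + ρ * ρ + η * ρ + ρ * η + ρ * ρ := by gcongr
      _ = 4 * η * ρ + 2 * ρ ^ 2 := by ring
  rw [hident]
  calc ‖(v * w - w * v) * (star V * star W) - (b * c - c * b)‖
      = ‖((v * w - w * v) * (star V * star W) - (v * w - w * v)) +
          ((v * w - w * v) - (b * c - c * b))‖ := by congr 1; abel
    _ ≤ ‖(v * w - w * v) * (star V * star W) - (v * w - w * v)‖ +
          ‖(v * w - w * v) - (b * c - c * b)‖ := norm_add_le _ _
    _ ≤ 4 * (η + ρ) ^ 3 + (4 * η * ρ + 2 * ρ ^ 2) := add_le_add hA hB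
    _ = 4 * (η + ρ) ^ 3 + 4 * η * ρ + 2 * ρ ^ 2 := by ring

end Literature.Computability.QuantumComplexity.SolovayKitaev
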